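import Summits.RiemannHypothesis.RiemannHypothesis.Theorems.WeilColumnThetaLagStepMajorant
import HarnessLib

/-!
# THETA certificate, tier 2, E5-bridge (ii): the FULL cross-term majorant — step hull on `[N, N e^{W_l})`, analytic tail beyond (RH-FREE)

Cell `rh-explicit`, WEIL column, seat weil-1 gen21 (cc-s2-1 gen22 TIER2-KERNEL-SPEC §2 «Cross term (E4/E5)», §5 (K4)). The partial
summation E5 (`ThetaPrime.sum_Ioc_vonMangoldt_mul_le_of_antitoneOn`) wants ONE nonnegative antitone majorant `F` of
`n ↦ n^{−1/2}·V(log(n/N))` on `[N, ∞)`. The kernel supplies a non-increasing hull `Gs_k` (`k < Kw`) on the lag cells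
`log(x/N) ∈ [kτ, (k+1)τ)` and, beyond `W_l = Kw·τ`, the closed form `Z²·w·e^{−(μ+1)w}` (`w = log(x/N)`; `Z = ζ(m+1)`, `μ = m`), glued by
`Z²·W_l·e^{−(μ+1)W_l} ≤ Gs_{Kw}` (`Gs` non-increasing up to `Kw`). This file defines that majorant,
`crossMajorant N τ Wl μ Z Gs Kw x = hullExt Gs Kw ⌊log(x/N)/τ⌋₊/√N + 𝟙[x ≥ N e^{W_l}]·Z² w e^{−(μ+1)w}/√N`, and proves: antitone on `[N, ∞)`
(`W_l ≥ 1/(μ+1)`), nonnegative, `N·F(N) = √N·Gs 0`, and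
`∫_N^b F ≤ √N·[Σ_{k<Kw} Gs_k(e^{(k+1)τ} − e^{kτ}) + Z²e^{−μW_l}(W_l/μ + 1/μ²)]` for every `b ≥ N` (the kernel's `integ + tailInt`).
Nothing here bears on the truth of RH.
-/

noncomputable section

set_option linter.dupNamespace false

open MeasureTheory Set Real

namespace Summit.RiemannHypothesis.RiemannHypothesis.Theorems.WeilColumn.ThetaPrime

/-- The hull sequence extended by `0` beyond the last lag cell: `hullExt Gs Kw k = Gs k` (`k < Kw`), `= 0` (`k ≥ Kw`). [this seat; TIER2-KERNEL-SPEC §2] -/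
def hullExt (Gs : ℕ → ℝ) (Kw : ℕ) (k : ℕ) : ℝ := if k < Kw then Gs k else 0

/-- The analytic tail of the cross-term majorant: `Z²·w·e^{−(μ+1)w}/√N`, `w = log(x/N)`. [this seat; TIER2-KERNEL-SPEC §2 (`GtailW`, `tailInt`)] -/
def crossTail (N μ Z : ℝ) (x : ℝ) : ℝ :=
  Z ^ 2 * Real.log (x / N) * Real.exp (-(μ + 1) * Real.log (x / N)) / Real.sqrt N

/-- **The cross-term majorant** `F(x) = hullExt Gs Kw ⌊log(x/N)/τ⌋₊/√N + 𝟙[N e^{W_l} ≤ x]·crossTail N μ Z x`. [this seat; TIER2-KERNEL-SPEC §2/§5 (K4)] -/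
def crossMajorant (N τ Wl μ Z : ℝ) (Gs : ℕ → ℝ) (Kw : ℕ) (x : ℝ) : ℝ :=
  hullExt Gs Kw ⌊Real.log (x / N) / τ⌋₊ / Real.sqrt N + (Set.Ici (N * Real.exp Wl)).indicator (crossTail N μ Z) x

variable {N τ Wl μ Z : ℝ} {Gs : ℕ → ℝ} {Kw : ℕ}

/-! ## §1 The extended hull -/

/-- `hullExt Gs Kw k = Gs k` for `k < Kw`. [folklore] -/
theorem hullExt_of_lt {k : ℕ} (hk : k < Kw) : hullExt Gs Kw k = Gs k := if_pos hk

/-- `hullExt Gs Kw k = 0` for `Kw ≤ k`. [folklore] -/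
theorem hullExt_of_le {k : ℕ} (hk : Kw ≤ k) : hullExt Gs Kw k = 0 := if_neg (not_lt.2 hk)

/-- `0 ≤ hullExt`. [folklore] -/
theorem hullExt_nonneg (hGs0 : ∀ k, 0 ≤ Gs k) (k : ℕ) : 0 ≤ hullExt Gs Kw k := by
  unfold hullExt; split_ifs <;> simp [hGs0]

/-- The extended hull is non-increasing when `Gs` is non-increasing up to `Kw` and nonnegative. [folklore] -/
theorem hullExt_succ_le (hGs0 : ∀ k, 0 ≤ Gs k) (hanti : ∀ k, k + 1 ≤ Kw → Gs (k + 1) ≤ Gs k) (k : ℕ) :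
    hullExt Gs Kw (k + 1) ≤ hullExt Gs Kw k := by
  unfold hullExt
  split_ifs with h1 h2 h2
  · exact hanti k h1.le
  · omega
  · exact hGs0 k
  · exact le_rfl

/-- `Gs Kw ≤ Gs k` for `k ≤ Kw`. [folklore] -/
theorem apply_Kw_le (hanti : ∀ k, k + 1 ≤ Kw → Gs (k + 1) ≤ Gs k) {k : ℕ} (hk : k ≤ Kw) : Gs Kw ≤ Gs k := by
  obtain ⟨d, rfl⟩ := Nat.exists_eq_add_of_le hk
  clear hk
  induction d with
  | zero => simp
  | succ d ih =>
    have h := hanti (k + d) (by omega)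
    have ih' := ih (fun j hj ↦ hanti j (by omega))
    calc Gs (k + (d + 1)) = Gs (k + d + 1) := by rw [Nat.add_assoc]
      _ ≤ Gs (k + d) := h
      _ ≤ Gs k := ih'

/-! ## §2 The analytic tail: nonnegative beyond `N`, antitone beyond `N e^{W_l}` -/

/-- `w ↦ w·e^{−cw}` is antitone on `[1/c, ∞)` (`c > 0`). [folklore] -/
theorem antitoneOn_mul_exp_neg {c : ℝ} (hc : 0 < c) : AntitoneOn (fun w : ℝ ↦ w * Real.exp (-c * w)) (Set.Ici (1 / c)) := by
  have hd : ∀ w, HasDerivAt (fun w : ℝ ↦ w * Real.exp (-c * w)) (Real.exp (-c * w) * (1 - c * w)) w := by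
    intro w
    have h1 : HasDerivAt (fun w : ℝ ↦ -c * w) (-c) w := by simpa using (hasDerivAt_id w).const_mul (-c)
    have h2 := h1.exp
    have h := (hasDerivAt_id' w).mul h2
    refine h.congr_deriv ?_
    ring
  refine antitoneOn_of_deriv_nonpos (convex_Ici _) ?_ ?_ ?_
  · exact (continuous_id.mul (Real.continuous_exp.comp (continuous_const.mul continuous_id))).continuousOn
  · exact fun w _ ↦ (hd w).differentiableAt.differentiableWithinAt
  · intro w hw
    rw [interior_Ici, Set.mem_Ioi] at hw
    rw [(hd w).deriv]
    have h1 : 1 < c * w := by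
      have := mul_lt_mul_of_pos_left hw hc
      rwa [mul_one_div_cancel hc.ne'] at this
    exact mul_nonpos_of_nonneg_of_nonpos (Real.exp_pos _).le (by linarith)

/-- For `0 < N ≤ x`: `0 ≤ log(x/N)`. [folklore] -/
theorem log_div_nonneg (hN : 0 < N) {x : ℝ} (hx : N ≤ x) : 0 ≤ Real.log (x / N) :=
  Real.log_nonneg ((one_le_div hN).2 hx)

/-- For `x ≥ N e^{W_l}` (`N > 0`): `W_l ≤ log(x/N)`. [folklore] -/
theorem le_log_div_of_ge (hN : 0 < N) {x : ℝ} (hx : N * Real.exp Wl ≤ x) : Wl ≤ Real.log (x / N) := by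
  have hx0 : 0 < x := lt_of_lt_of_le (by positivity) hx
  rw [Real.le_log_iff_exp_le (div_pos hx0 hN), le_div_iff₀ hN]
  linarith

/-- `0 ≤ crossTail N μ Z x` for `x ≥ N > 0`. [folklore] -/
theorem crossTail_nonneg (hN : 0 < N) {x : ℝ} (hx : N ≤ x) : 0 ≤ crossTail N μ Z x := by
  unfold crossTail
  have := log_div_nonneg hN hx
  positivity

/-- The tail is antitone on `[N e^{W_l}, ∞)` when `W_l ≥ 1/(μ+1)`, `μ + 1 > 0`. [folklore] -/
theorem crossTail_antitoneOn (hN : 0 < N) (hμ : 0 < μ + 1) (hWl : 1 / (μ + 1) ≤ Wl) :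
    AntitoneOn (crossTail N μ Z) (Set.Ici (N * Real.exp Wl)) := by
  intro x hx y hy hxy
  have hx0 : 0 < x := lt_of_lt_of_le (by positivity) (show N * Real.exp Wl ≤ x from hx)
  have hlx : Wl ≤ Real.log (x / N) := le_log_div_of_ge hN hx
  have hly : Wl ≤ Real.log (y / N) := le_log_div_of_ge hN hy
  have hlxy : Real.log (x / N) ≤ Real.log (y / N) :=
    Real.log_le_log (div_pos hx0 hN) (div_le_div_of_nonneg_right hxy hN.le)
  have h := antitoneOn_mul_exp_neg hμ (show Real.log (x / N) ∈ Set.Ici (1 / (μ + 1)) from le_trans hWl hlx)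
    (show Real.log (y / N) ∈ Set.Ici (1 / (μ + 1)) from le_trans hWl hly) hlxy
  unfold crossTail
  have hs : 0 ≤ Z ^ 2 / Real.sqrt N := by positivity
  have := mul_le_mul_of_nonneg_left h hs
  calc Z ^ 2 * Real.log (y / N) * Real.exp (-(μ + 1) * Real.log (y / N)) / Real.sqrt N
      = Z ^ 2 / Real.sqrt N * (Real.log (y / N) * Real.exp (-(μ + 1) * Real.log (y / N))) := by ring
    _ ≤ Z ^ 2 / Real.sqrt N * (Real.log (x / N) * Real.exp (-(μ + 1) * Real.log (x / N))) := this
    _ = Z ^ 2 * Real.log (x / N) * Real.exp (-(μ + 1) * Real.log (x / N)) / Real.sqrt N := by ring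

/-- The value of the tail at the gluing point: `crossTail (N e^{W_l}) = Z²·W_l·e^{−(μ+1)W_l}/√N`. [folklore] -/
theorem crossTail_at_glue (hN : 0 < N) : crossTail N μ Z (N * Real.exp Wl) = Z ^ 2 * Wl * Real.exp (-(μ + 1) * Wl) / Real.sqrt N := by
  unfold crossTail
  rw [mul_div_cancel_left₀ _ hN.ne', Real.log_exp]

/-! ## §3 The majorant: nonnegative, antitone on `[N, ∞)`, boundary value -/

/-- `0 ≤ F x` for `x ≥ N`. [folklore] -/
theorem crossMajorant_nonneg (hN : 0 < N) (hGs0 : ∀ k, 0 ≤ Gs k) {x : ℝ} (hx : N ≤ x) :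
    0 ≤ crossMajorant N τ Wl μ Z Gs Kw x := by
  unfold crossMajorant
  refine add_nonneg (div_nonneg (hullExt_nonneg hGs0 _) (Real.sqrt_nonneg _)) ?_
  exact Set.indicator_nonneg (fun y _ ↦ crossTail_nonneg hN hx) _

/-- The step part vanishes beyond `N e^{W_l}` (`W_l = Kw·τ`). [folklore] -/
theorem hullExt_lagCell_eq_zero (hN : 0 < N) (hτ : 0 < τ) (hWl : Wl = Kw * τ) {x : ℝ} (hx : N * Real.exp Wl ≤ x) :
    hullExt Gs Kw ⌊Real.log (x / N) / τ⌋₊ = 0 := by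
  refine hullExt_of_le (Nat.le_floor ?_)
  rw [le_div_iff₀ hτ, ← hWl]
  exact le_log_div_of_ge hN hx

/-- Below `N e^{W_l}` the lag-cell index is `< Kw` (for `x ≥ N`). [folklore] -/
theorem lagCell_lt_of_lt (hN : 0 < N) (hτ : 0 < τ) (hWl : Wl = Kw * τ) {x : ℝ} (hxN : N ≤ x) (hx : x < N * Real.exp Wl) :
    ⌊Real.log (x / N) / τ⌋₊ < Kw := by
  have hx0 : 0 < x := hN.trans_le hxN
  have hlog : Real.log (x / N) < Wl := by
    rw [Real.log_lt_iff_lt_exp (div_pos hx0 hN), div_lt_iff₀ hN]; linarith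
  have h0 : 0 ≤ Real.log (x / N) / τ := div_nonneg (log_div_nonneg hN hxN) hτ.le
  have : Real.log (x / N) / τ < Kw := by rw [div_lt_iff₀ hτ, ← hWl]; exact hlog
  exact (Nat.floor_lt h0).2 this

/-- **`F` is antitone on `[N, ∞)`** (`Gs ≥ 0` non-increasing up to `Kw`, glue `Z²W_l e^{−(μ+1)W_l} ≤ Gs Kw`, `W_l = Kwτ ≥ 1/(μ+1)`). [TIER2-KERNEL-SPEC §2 E5] -/
theorem crossMajorant_antitoneOn (hN : 0 < N) (hτ : 0 < τ) (hWl : Wl = Kw * τ) (hμ : 0 < μ + 1) (hWl1 : 1 / (μ + 1) ≤ Wl)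
    (hGs0 : ∀ k, 0 ≤ Gs k) (hanti : ∀ k, k + 1 ≤ Kw → Gs (k + 1) ≤ Gs k)
    (hglue : Z ^ 2 * Wl * Real.exp (-(μ + 1) * Wl) ≤ Gs Kw) :
    AntitoneOn (crossMajorant N τ Wl μ Z Gs Kw) (Set.Ici N) := by
  have hstep : AntitoneOn (fun x : ℝ ↦ hullExt Gs Kw ⌊Real.log (x / N) / τ⌋₊ / Real.sqrt N) (Set.Ici N) :=
    stepMajorant_antitoneOn hN hτ (hullExt_succ_le hGs0 hanti)
  have htail := crossTail_antitoneOn (Z := Z) hN hμ hWl1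
  set A := N * Real.exp Wl with hA
  intro x hx y hy hxy
  unfold crossMajorant
  rcases lt_or_ge y A with hyA | hyA
  · -- both below the glue: tails vanish
    have hxA : x < A := lt_of_le_of_lt hxy hyA
    rw [Set.indicator_of_notMem (show y ∉ Set.Ici A from fun h ↦ not_le.2 hyA h),
      Set.indicator_of_notMem (show x ∉ Set.Ici A from fun h ↦ not_le.2 hxA h), add_zero, add_zero]
    exact hstep hx hy hxy
  · rcases lt_or_ge x A with hxA | hxA
    · -- `x` below, `y` above the glue
      rw [Set.indicator_of_notMem (show x ∉ Set.Ici A from fun h ↦ not_le.2 hxA h), add_zero,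
        Set.indicator_of_mem (show y ∈ Set.Ici A from hyA), hullExt_lagCell_eq_zero hN hτ hWl hyA, zero_div, zero_add]
      have hk : ⌊Real.log (x / N) / τ⌋₊ < Kw := lagCell_lt_of_lt hN hτ hWl hx hxA
      rw [hullExt_of_lt hk]
      calc crossTail N μ Z y ≤ crossTail N μ Z A := htail (self_mem_Ici) hyA hyA
        _ = Z ^ 2 * Wl * Real.exp (-(μ + 1) * Wl) / Real.sqrt N := crossTail_at_glue hN
        _ ≤ Gs Kw / Real.sqrt N := div_le_div_of_nonneg_right hglue (Real.sqrt_nonneg _)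
        _ ≤ Gs ⌊Real.log (x / N) / τ⌋₊ / Real.sqrt N := div_le_div_of_nonneg_right (apply_Kw_le hanti hk.le) (Real.sqrt_nonneg _)
    · -- both above the glue: steps vanish
      rw [Set.indicator_of_mem (show x ∈ Set.Ici A from hxA), Set.indicator_of_mem (show y ∈ Set.Ici A from hyA),
        hullExt_lagCell_eq_zero hN hτ hWl hxA, hullExt_lagCell_eq_zero hN hτ hWl hyA, zero_div, zero_add, zero_add]
      exact htail hxA hyA hxy

/-- **Boundary value**: `N·F(N) = √N·Gs 0` (`Kw ≥ 1`, `W_l > 0`). [folklore] -/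
theorem crossMajorant_boundary (hN : 0 < N) (hKw : 0 < Kw) (hWl0 : 0 < Wl) :
    N * crossMajorant N τ Wl μ Z Gs Kw N = Real.sqrt N * Gs 0 := by
  unfold crossMajorant
  have hnot : N ∉ Set.Ici (N * Real.exp Wl) := by
    intro h
    have : N * Real.exp Wl ≤ N * 1 := by simpa using (h : N * Real.exp Wl ≤ N)
    have h1 : Real.exp Wl ≤ 1 := le_of_mul_le_mul_left this hN
    linarith [Real.one_lt_exp_iff.2 hWl0]
  rw [Set.indicator_of_notMem hnot, add_zero, stepMajorant_boundary hN, hullExt_of_lt hKw]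

/-! ## §4 The integral of the majorant -/

/-- The step part is interval integrable on any `[a, b] ⊆ [N, ∞)`. [folklore] -/
theorem intervalIntegrable_step (hN : 0 < N) (hτ : 0 < τ) (hGs0 : ∀ k, 0 ≤ Gs k)
    (hanti : ∀ k, k + 1 ≤ Kw → Gs (k + 1) ≤ Gs k) {a b : ℝ} (ha : N ≤ a) (hab : a ≤ b) :
    IntervalIntegrable (fun x : ℝ ↦ hullExt Gs Kw ⌊Real.log (x / N) / τ⌋₊ / Real.sqrt N) volume a b := by
  refine ((stepMajorant_antitoneOn hN hτ (hullExt_succ_le hGs0 hanti)).mono fun x hx ↦ ?_).intervalIntegrable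
  rw [Set.uIcc_of_le hab, Set.mem_Icc] at hx
  exact le_trans ha hx.1

/-- **The step part integrates to at most `√N·Σ_{k<Kw} Gs_k(e^{(k+1)τ} − e^{kτ})`** over any `[N, b]`. [TIER2-KERNEL-SPEC §2 (`integ`)] -/
theorem integral_step_le (hN : 0 < N) (hτ : 0 < τ) (hWl : Wl = Kw * τ) (hGs0 : ∀ k, 0 ≤ Gs k)
    (hanti : ∀ k, k + 1 ≤ Kw → Gs (k + 1) ≤ Gs k) {b : ℝ} (hb : N ≤ b) :
    ∫ x in N..b, hullExt Gs Kw ⌊Real.log (x / N) / τ⌋₊ / Real.sqrt N ≤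
      Real.sqrt N * ∑ k ∈ Finset.range Kw, Gs k * (Real.exp ((k + 1) * τ) - Real.exp (k * τ)) := by
  set A := N * Real.exp Wl with hA
  have hNA : N ≤ A := by rw [hA]; nlinarith [Real.one_le_exp (show 0 ≤ Wl by rw [hWl]; positivity)]
  have hfull := integral_stepMajorant_le (Gs := hullExt Gs Kw) hN hτ (hullExt_succ_le hGs0 hanti) Kw
  have hsum : ∑ k ∈ Finset.range Kw, hullExt Gs Kw k * (Real.exp ((k + 1) * τ) - Real.exp (k * τ)) =
      ∑ k ∈ Finset.range Kw, Gs k * (Real.exp ((k + 1) * τ) - Real.exp (k * τ)) :=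
    Finset.sum_congr rfl fun k hk ↦ by rw [hullExt_of_lt (Finset.mem_range.1 hk)]
  rw [hsum, show (Kw : ℝ) * τ = Wl from hWl.symm] at hfull
  -- `∫_N^b ≤ ∫_N^{max b A} = ∫_N^A + ∫_A^{max b A}`, the last integrand being `0`
  set B := max b A with hB
  have hbB : b ≤ B := le_max_left _ _
  have hAB : A ≤ B := le_max_right _ _
  have hiNB := intervalIntegrable_step (Kw := Kw) hN hτ hGs0 hanti le_rfl (hb.trans hbB)
  have h1 : ∫ x in N..b, hullExt Gs Kw ⌊Real.log (x / N) / τ⌋₊ / Real.sqrt N ≤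
      ∫ x in N..B, hullExt Gs Kw ⌊Real.log (x / N) / τ⌋₊ / Real.sqrt N :=
    intervalIntegral.integral_mono_interval le_rfl hb hbB
      (Filter.Eventually.of_forall fun x ↦ div_nonneg (hullExt_nonneg hGs0 _) (Real.sqrt_nonneg _)) hiNB
  have hsplit : ∫ x in N..B, hullExt Gs Kw ⌊Real.log (x / N) / τ⌋₊ / Real.sqrt N =
      (∫ x in N..A, hullExt Gs Kw ⌊Real.log (x / N) / τ⌋₊ / Real.sqrt N) +
        ∫ x in A..B, hullExt Gs Kw ⌊Real.log (x / N) / τ⌋₊ / Real.sqrt N :=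
    (intervalIntegral.integral_add_adjacent_intervals (intervalIntegrable_step hN hτ hGs0 hanti le_rfl hNA)
      (intervalIntegrable_step hN hτ hGs0 hanti hNA hAB)).symm
  have hzero : ∫ x in A..B, hullExt Gs Kw ⌊Real.log (x / N) / τ⌋₊ / Real.sqrt N = 0 := by
    rw [intervalIntegral.integral_congr (g := fun _ ↦ (0 : ℝ)) fun x hx ↦ ?_]
    · simp
    · rw [Set.uIcc_of_le hAB, Set.mem_Icc] at hx
      show hullExt Gs Kw ⌊Real.log (x / N) / τ⌋₊ / Real.sqrt N = 0
      rw [hullExt_lagCell_eq_zero hN hτ hWl hx.1, zero_div]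
  rw [hsplit, hzero, add_zero] at h1
  exact h1.trans hfull

/-- The antiderivative of the tail: `Φ(x) = −√N·Z²·e^{−μw}(w/μ + 1/μ²)`, `w = log(x/N)`, has `Φ′ = crossTail` on `x > 0` (`μ ≠ 0`). [folklore] -/
theorem hasDerivAt_crossTail_primitive (hN : 0 < N) (hμ : μ ≠ 0) {x : ℝ} (hx : 0 < x) :
    HasDerivAt (fun x : ℝ ↦ -(Real.sqrt N * Z ^ 2) * (Real.exp (-μ * Real.log (x / N)) * (Real.log (x / N) / μ + 1 / μ ^ 2)))
      (crossTail N μ Z x) x := by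
  -- `w = log(x/N)`, `w′ = 1/x`
  have hL : HasDerivAt (fun x : ℝ ↦ Real.log (x / N)) (1 / x) x := by
    have h := ((hasDerivAt_id' x).div_const N).log (div_pos hx hN).ne'
    refine h.congr_deriv ?_
    field_simp
  have hE : HasDerivAt (fun x : ℝ ↦ Real.exp (-μ * Real.log (x / N))) (Real.exp (-μ * Real.log (x / N)) * (-μ * (1 / x))) x :=
    (hL.const_mul (-μ)).exp
  have hP : HasDerivAt (fun x : ℝ ↦ Real.log (x / N) / μ + 1 / μ ^ 2) ((1 / x) / μ) x := by
    simpa using (hL.div_const μ).add_const (1 / μ ^ 2)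
  have h := ((hE.mul hP).const_mul (-(Real.sqrt N * Z ^ 2)))
  refine h.congr_deriv ?_
  -- the algebra: `e^{−w} = N/x`, `N/√N = √N`
  have hexp : Real.exp (-(μ + 1) * Real.log (x / N)) = Real.exp (-μ * Real.log (x / N)) * (N / x) := by
    rw [show -(μ + 1) * Real.log (x / N) = -μ * Real.log (x / N) + -Real.log (x / N) by ring, Real.exp_add,
      Real.exp_neg, Real.exp_log (div_pos hx hN), inv_div]
  unfold crossTail
  rw [hexp]
  set s := Real.sqrt N with hs
  have hs0 : s ≠ 0 := by rw [hs]; exact (Real.sqrt_pos.2 hN).ne'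
  have hN' : N = s ^ 2 := by rw [hs, Real.sq_sqrt hN.le]
  have hx0 : x ≠ 0 := hx.ne'
  generalize Real.exp (-μ * Real.log (x / N)) = E
  generalize Real.log (x / N) = L
  rw [hN']
  field_simp
  ring

/-- The tail is continuous on `(0, ∞)`. [folklore] -/
theorem continuousOn_crossTail (hN : 0 < N) : ContinuousOn (crossTail N μ Z) (Set.Ioi 0) := by
  have hlog : ContinuousOn (fun x : ℝ ↦ Real.log (x / N)) (Set.Ioi 0) :=
    (Real.continuousOn_log.comp (continuous_id.div_const N).continuousOn fun x hx ↦
      Set.mem_compl_singleton_iff.2 (div_pos hx hN).ne')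
  unfold crossTail
  exact (((continuousOn_const.mul hlog).mul (Real.continuous_exp.comp_continuousOn (continuousOn_const.mul hlog))).div_const _)

/-- **The tail part integrates to at most `√N·Z²·e^{−μW_l}(W_l/μ + 1/μ²)`** over any `[N, b]` (`μ > 0`, `W_l ≥ 0`). [TIER2-KERNEL-SPEC §2 (`tailInt`)] -/
theorem integral_tail_le (hN : 0 < N) (hμ : 0 < μ) (hWl0 : 0 ≤ Wl) {b : ℝ} (hb : N ≤ b) :
    ∫ x in N..b, (Set.Ici (N * Real.exp Wl)).indicator (crossTail N μ Z) x ≤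
      Real.sqrt N * (Z ^ 2 * Real.exp (-μ * Wl) * (Wl / μ + 1 / μ ^ 2)) := by
  set A := N * Real.exp Wl with hA
  have hA0 : 0 < A := by positivity
  have hNA : N ≤ A := by rw [hA]; nlinarith [Real.one_le_exp hWl0]
  have hRHS : 0 ≤ Real.sqrt N * (Z ^ 2 * Real.exp (-μ * Wl) * (Wl / μ + 1 / μ ^ 2)) := by positivity
  -- interval integrability of the (piecewise continuous) integrand on `[N, c]`
  have hint : ∀ c, N ≤ c → IntervalIntegrable (fun x ↦ (Set.Ici A).indicator (crossTail N μ Z) x) volume N c := by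
    intro c hc
    refine MeasureTheory.IntegrableOn.intervalIntegrable ?_
    rw [Set.uIcc_of_le hc]
    refine (integrableOn_indicator_iff measurableSet_Ici).2 ?_
    have hK : IntegrableOn (crossTail N μ Z) (Set.Icc A (max c A)) :=
      ((continuousOn_crossTail hN).mono fun x hx ↦ lt_of_lt_of_le hA0 hx.1).integrableOn_compact isCompact_Icc
    exact hK.mono_set fun x hx ↦ ⟨hx.1, le_trans hx.2.2 (le_max_left _ _)⟩
  -- below `A` the integrand vanishes (a.e. on `(N, c)`)
  have hvan : ∀ c, N ≤ c → c ≤ A → ∫ x in N..c, (Set.Ici A).indicator (crossTail N μ Z) x = 0 := by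
    intro c hNc hc
    rw [intervalIntegral.integral_of_le hNc, integral_Ioc_eq_integral_Ioo,
      setIntegral_congr_fun measurableSet_Ioo (g := fun _ ↦ (0 : ℝ)) fun x hx ↦ ?_]
    · simp
    · exact Set.indicator_of_notMem (fun h ↦ not_lt.2 (h : A ≤ x) (lt_of_lt_of_le hx.2 hc)) _
  rcases le_or_gt b A with hbA | hAb
  · rw [hvan b hb hbA]; exact hRHS
  · -- `∫_N^b = ∫_N^A + ∫_A^b`, the first vanishes, the second is `Φ(b) − Φ(A) ≤ −Φ(A)`
    have hiAb' : IntervalIntegrable (fun x ↦ (Set.Ici A).indicator (crossTail N μ Z) x) volume A b :=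
      (hint b hb).mono_set (by rw [Set.uIcc_of_le hb, Set.uIcc_of_le hAb.le]; exact Set.Icc_subset_Icc_left hNA)
    have hsplit := (intervalIntegral.integral_add_adjacent_intervals (hint A hNA) hiAb').symm
    rw [hsplit, hvan A hNA le_rfl, zero_add]
    have hcongr : ∫ x in A..b, (Set.Ici A).indicator (crossTail N μ Z) x = ∫ x in A..b, crossTail N μ Z x :=
      intervalIntegral.integral_congr fun x hx ↦ by
        rw [Set.uIcc_of_le hAb.le] at hx
        exact Set.indicator_of_mem (show x ∈ Set.Ici A from hx.1) _
    rw [hcongr]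
    have hcont : ContinuousOn (crossTail N μ Z) (Set.uIcc A b) := by
      rw [Set.uIcc_of_le hAb.le]
      exact (continuousOn_crossTail hN).mono fun x hx ↦ lt_of_lt_of_le hA0 hx.1
    have hderiv : ∀ x ∈ Set.uIcc A b, HasDerivAt
        (fun x : ℝ ↦ -(Real.sqrt N * Z ^ 2) * (Real.exp (-μ * Real.log (x / N)) * (Real.log (x / N) / μ + 1 / μ ^ 2)))
        (crossTail N μ Z x) x := fun x hx ↦ by
      rw [Set.uIcc_of_le hAb.le] at hx
      exact hasDerivAt_crossTail_primitive hN hμ.ne' (lt_of_lt_of_le hA0 hx.1)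
    rw [intervalIntegral.integral_eq_sub_of_hasDerivAt hderiv hcont.intervalIntegrable]
    have hlogA : Real.log (A / N) = Wl := by rw [hA, mul_div_cancel_left₀ _ hN.ne', Real.log_exp]
    have hlogb : 0 ≤ Real.log (b / N) := log_div_nonneg hN hb
    rw [hlogA]
    have hΦb : -(Real.sqrt N * Z ^ 2) * (Real.exp (-μ * Real.log (b / N)) * (Real.log (b / N) / μ + 1 / μ ^ 2)) ≤ 0 := by
      have : 0 ≤ Real.sqrt N * Z ^ 2 * (Real.exp (-μ * Real.log (b / N)) * (Real.log (b / N) / μ + 1 / μ ^ 2)) := by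
        positivity
      linarith
    have e : -(-(Real.sqrt N * Z ^ 2) * (Real.exp (-μ * Wl) * (Wl / μ + 1 / μ ^ 2))) =
        Real.sqrt N * (Z ^ 2 * Real.exp (-μ * Wl) * (Wl / μ + 1 / μ ^ 2)) := by ring
    linarith [e]

/-- **The integral of the majorant**: `∫_N^b F ≤ √N·[Σ_{k<Kw} Gs_k(e^{(k+1)τ} − e^{kτ}) + Z²e^{−μW_l}(W_l/μ + 1/μ²)]` for every `b ≥ N`.
[TIER2-KERNEL-SPEC §2 (`integ + tailInt`)] -/
theorem integral_crossMajorant_le (hN : 0 < N) (hτ : 0 < τ) (hWl : Wl = Kw * τ) (hμ : 0 < μ) (hGs0 : ∀ k, 0 ≤ Gs k)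
    (hanti : ∀ k, k + 1 ≤ Kw → Gs (k + 1) ≤ Gs k) {b : ℝ} (hb : N ≤ b) :
    ∫ x in N..b, crossMajorant N τ Wl μ Z Gs Kw x ≤
      Real.sqrt N * (∑ k ∈ Finset.range Kw, Gs k * (Real.exp ((k + 1) * τ) - Real.exp (k * τ)) +
        Z ^ 2 * Real.exp (-μ * Wl) * (Wl / μ + 1 / μ ^ 2)) := by
  have hWl0 : 0 ≤ Wl := by rw [hWl]; positivity
  have h1 := integral_step_le (Kw := Kw) hN hτ hWl hGs0 hanti hb
  have h2 := integral_tail_le (Z := Z) hN hμ hWl0 hb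
  have hi1 := intervalIntegrable_step (Kw := Kw) hN hτ hGs0 hanti le_rfl hb
  -- integrability of the tail part on `[N, b]` (piecewise continuous)
  have hA0 : 0 < N * Real.exp Wl := by positivity
  have hi2 : IntervalIntegrable (fun x ↦ (Set.Ici (N * Real.exp Wl)).indicator (crossTail N μ Z) x) volume N b := by
    refine MeasureTheory.IntegrableOn.intervalIntegrable ?_
    rw [Set.uIcc_of_le hb]
    refine (integrableOn_indicator_iff measurableSet_Ici).2 ?_
    have hK : IntegrableOn (crossTail N μ Z) (Set.Icc (N * Real.exp Wl) (max b (N * Real.exp Wl))) :=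
      ((continuousOn_crossTail hN).mono fun x hx ↦ lt_of_lt_of_le hA0 hx.1).integrableOn_compact isCompact_Icc
    exact hK.mono_set fun x hx ↦ ⟨hx.1, le_trans hx.2.2 (le_max_left _ _)⟩
  unfold crossMajorant
  rw [intervalIntegral.integral_add hi1 hi2, mul_add]
  exact add_le_add h1 h2

end Summit.RiemannHypothesis.RiemannHypothesis.Theorems.WeilColumn.ThetaPrime

end
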